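import Summits.BirchSwinnertonDyer.Rank1Residual.Supersingular.KobayashiMainConjecture
import Literature.NumberTheory.EllipticCurves.Rank1Residual.Typed.X7
import Summits.BirchSwinnertonDyer.BirchSwinnertonDyer.Theorems.ToricSheddingUBPotentiallyGoodStubTwistAdmissible
import HarnessLib

/-!
# Kobayashi's signed main conjecture on the real objects: the X7 readings (non-semistable `E`,
# good supersingular `p`, `a_p = 0`) and the TWIST CLAUSE of Burungale–Skinner–Tian–Wan Thm. 1.3 as
# an OPEN hypothesis (cell `b2b-bsdres`, supersingular family, prover A = unit `b2b-bsdres-x10b`, gen 4)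

HONEST FRAMING (run/shared/lean/b2b/bsd-rank1-residual/, verbatim in every file): the goal of the
cell is to DELETE the COMBINATION-SHAPED residual classes of the Birch–Swinnerton-Dyer formula for
ALL analytic-rank `≤ 1` elliptic curves over `ℚ` — "full BSD formula for every rank `≤ 1` curve in
class `C`" assembled STRICTLY from published theorems — so that the rank-`≤ 1` remainder becomes
exactly the CONSTRUCTION-SHAPED classes, which are TYPED (missing-input `Prop`s), NOT attempted.
This is not "finishing BSD". Class X7 (`ss(p) ∧ ¬sst`) stays CONSTRUCTION-SHAPED; nothing about any
curve is asserted; the ANNOUNCED preprint BSTW arXiv:2409.01350v2 enters ONLY as an explicitly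
labelled OPEN hypothesis (FRESHNESS 2026-08-20: still a preprint). Joint X7 step of the pair
A (x10b) / B (additive-p3); companion of `Supersingular/KobayashiMainConjecture.lean` (p209365: the
typed inputs `KobayashiMainConjecture W p ε`, `KobayashiLowerDivisibility W p ε` on Kobayashi's real
objects, and the X6 rank-0 chain `missingLowerBoundAt_of_kobayashiLowerDivisibility`) and of B's
SHAPE reading `Supersingular/SignedRankZeroX7.lean` (p207423).

## Contents

* `ClassX7.frobeniusTrace_eq_zero_of_five_le` — `a_p = 0` on X7 for `p ≥ 5` (Hasse);
* `X7.bsdp_of_kobayashiLowerDivisibility_of_surj_of_analyticRank_eq_zero` — X7 ∧ r_an = 0 ∧ odd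
  `p` ∧ `a_p = 0` ∧ `Surj W p`: Wuthrich Prop. 21 + Kobayashi Thm. 1.2 + Kim Cor. 3.15 + Pollack +
  modularity + GZK (PUB, named) + `KobayashiLowerDivisibility W p ε` for ONE sign ⇒ `BSDp W p`
  (Kobayashi/Kim/Pollack need only good supersingular reduction at `p` with `a_p = 0`);
* `BurungaleSkinnerTianWan2024_thm13_twist_OPEN` — Thm. 1.3 WITH its twist clause ("the same holds
  for any quadratic twist `E^K := E ⊗ χ_K` … with discriminant coprime to `Np` and divisible only by
  primes of ordinary reduction for `E`"), transcribed onto `KobayashiMainConjecture`; `[claim]`, NEVER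
  a theorem. These twists are additive exactly at the primes of `d_K`, i.e. X7 pairs (iw-2 census:
  11 of 332 X7 pairs `N < 2·10⁴` meet the clause, `tables/x7_twist_clause.tsv`);
* `X7.bsdp_of_BSTW13_twist_OPEN_of_analyticRank_eq_zero` — the kernel REFEREES the twist clause in
  rank `0`: granted it, `BSD(E ⊗ χ_K, p)` for such twists in X7 with `a_p = 0`, `r_an = 0` follows
  from published inputs by name; surjectivity of `ρ̄_{E⊗χ_K,p}` is DERIVED from Serre Prop. 21 i)
  for the semistable `E` and transported to the twist.

References: [Kobayashi2003] Thm. 1.2, (3.6); [BDKim2013] Cor. 3.15; [Pollack2003] Prop. 6.18;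
[BurungaleSkinnerTianWan2024] Thm. 1.3 (PRE); [Wuthrich2014] Prop. 21; [Serre1972] §5.4 Prop. 21 i);
[SilvermanAEC2009] X.5 Cor. 5.4; [Miller2011LMS] Def. 1.1.
-/

set_option autoImplicit false

noncomputable section

open scoped Classical MatrixGroups ModularForm

open CongruenceSubgroup WeierstrassCurve Literature.NumberTheory.EllipticCurves
  Literature.NumberTheory.EllipticCurves.ModularForms
  Literature.NumberTheory.EllipticCurves.Rank1Residual
  Literature.NumberTheory.EllipticCurves.Rank1Residual.Typed
  Literature.NumberTheory.EllipticCurves.Kobayashi2003 ZpExtension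

namespace Summit.BirchSwinnertonDyer.Rank1Residual.Supersingular

/-! ### X7 readings and the twist clause of BSTW Thm. 1.3 -/

section X7

variable (W : WeierstrassCurve ℚ) [W.IsElliptic] [W.IsGloballyMinimal] (p : ℕ) [Fact p.Prime]

/-- On class X7 at a prime `p ≥ 5`, `a_p = 0` (Hasse; `natCast_dvd_frobeniusTrace_iff_eq_zero`). At
`p = 3` class X7 also contains `a_3 = ±3` pairs (the ♯/♭ side), so there `a_3 = 0` is a hypothesis.
[cite: Serre1981, §8.1–8.2 (pp. 188–189)] -/
theorem ClassX7.frobeniusTrace_eq_zero_of_five_le (hp5 : 5 ≤ p) (hX : ClassX7 W p) :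
    W.frobeniusTrace p = 0 :=
  (W.natCast_dvd_frobeniusTrace_iff_eq_zero p hp5 hX.1.1).mp hX.1.2

/-- **X7 ∩ {r_an = 0}, odd `p`, `a_p = 0`, surjective `ρ̄_{E,p}`: `BSD(E,p)` from the Eisenstein half
of Kobayashi's main conjecture for ONE sign** — the X7 reading of
`missingLowerBoundAt_of_kobayashiLowerDivisibility` (Kobayashi/Kim/Pollack need only good
supersingular reduction at `p` with `a_p = 0`, not semistability), closed by Wuthrich 2014 Prop. 21
under `Surj W p` (`X7.bsdp_of_missingLowerBoundAt_of_surj`); irreducibility automatic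
(`ClassX7.irr`). Every input but `KobayashiLowerDivisibility W p ε` is PUBLISHED and named; for
non-semistable `E` NOTHING is announced for that input except BSTW's twist clause
(`BurungaleSkinnerTianWan2024_thm13_twist_OPEN`). [cite: Wuthrich2014, Prop. 21 (p. 400)]
[cite: Kobayashi2003, Thm. 1.2 and (3.6)] [cite: BDKim2013, Cor. 3.15 (p. 199)] [cite: Miller2011LMS, Def. 1.1] -/
theorem X7.bsdp_of_kobayashiLowerDivisibility_of_surj_of_analyticRank_eq_zero
    (hW : Wuthrich2014.sha_dvd_analyticSha)
    (h12 : Kobayashi2003.thm12_signedSelmerDual_finite_torsion)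
    (hKim : BDKim2013.cor315_signedCharValue_rankZero)
    (hPollack : ∀ {N : ℕ} [NeZero N] {f : CuspForm (Gamma0 N) 2},
      pollack_exists_plusMinusPAdicLFunction (W := W) (f := f) (p := p))
    (hmod : nonempty_modularParametrizationData) (hmod' : hasEntireLFunction_rat)
    (hGZK : rank_eq_analyticRank_of_analyticRank_le_one)
    (hp : p ≠ 2) (hX : ClassX7 W p) (hap : W.frobeniusTrace p = 0) (hs : Surj W p)
    (h0 : W.analyticRank = 0) {ε : ℤˣ} (hdiv : KobayashiLowerDivisibility W p ε) : BSDp W p := by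
  have hL : W.entireLFunction 1 ≠ 0 := (W.analyticRank_eq_zero_iff_holds (hmod' W)).1 h0
  exact X7.bsdp_of_missingLowerBoundAt_of_surj W p hW hGZK hmod' hp hX hs h0
    (missingLowerBoundAt_of_kobayashiLowerDivisibility W p h12 hKim hPollack hmod hGZK hp hX.1.1 hap
      (ClassX7.irr W p hp hX) hL hdiv)

/-- **OPEN HYPOTHESIS — UNREFEREED PREPRINT (Burungale–Skinner–Tian–Wan, arXiv:2409.01350v2),
Thm. 1.3 WITH ITS TWIST CLAUSE.** "Let `E/ℚ` be a semistable elliptic curve, and `p > 2` a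
supersingular prime. If `p = 3`, suppose that (h4) holds. Then Kobayashi's Conjecture (Kob) is true
… Moreover, the same holds for any quadratic twist `E^K := E ⊗ χ_K` for `χ_K` the character
associated to a quadratic field extension `K/ℚ` with discriminant coprime to `Np` and divisible
only by primes of ordinary reduction for `E`." Transcribed: `W` globally minimal, `p ≠ 2`,
`Semistable W`, `GoodSS W p`, `p = 3 → a_3 = 0`; `K` a quadratic number field (`finrank_ℚ K = 2`)
with `d_K` coprime to `N_E · p` and every prime `ℓ ∣ d_K` good ordinary for `W` (`GoodOrd W ℓ`);
`Wd` any globally minimal model of the twist `W^{(d_K)} = E ⊗ χ_K` (`C • W.quadraticTwist d_K = Wd`)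
⇒ `KobayashiMainConjecture Wd p ε` for every sign. These twists are additive at the primes of
`d_K`: for `d_K ≠ 1` they are X7 pairs (iw-2: 11 of 332 X7 pairs `N < 2·10⁴` meet the clause). NEVER
cite this `Prop` as a theorem; take it as an explicit hypothesis.
[claim: BurungaleSkinnerTianWan2024, status: under-review] -/
def BurungaleSkinnerTianWan2024_thm13_twist_OPEN : Prop :=
  ∀ (W : WeierstrassCurve ℚ) [W.IsElliptic] [W.IsGloballyMinimal] (p : ℕ) [Fact p.Prime],
    p ≠ 2 → Semistable W → GoodSS W p → (p = 3 → W.frobeniusTrace 3 = 0) →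
    ∀ (K : Type) [Field K] [NumberField K], Module.finrank ℚ K = 2 →
      IsCoprime (NumberField.discr K) ((W.conductorNorm ℤ * p : ℕ) : ℤ) →
      (∀ (ℓ : ℕ) [Fact ℓ.Prime], (ℓ : ℤ) ∣ NumberField.discr K → GoodOrd W ℓ) →
    ∀ (Wd : WeierstrassCurve ℚ) [Wd.IsElliptic] [Wd.IsGloballyMinimal],
      (∃ C : VariableChange ℚ, C • W.quadraticTwist (NumberField.discr K : ℚ) = Wd) →
      ∀ ε : ℤˣ, KobayashiMainConjecture Wd p ε

/-- The twist clause at a pair `(Wd, p)` delivers the Eisenstein half `KobayashiLowerDivisibility Wd p ε`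
(bookkeeping: OPEN main conjecture ⇒ its lower half). [claim: BurungaleSkinnerTianWan2024, status: under-review] -/
theorem kobayashiLowerDivisibility_of_BSTW13_twist_OPEN
    (hBSTW : BurungaleSkinnerTianWan2024_thm13_twist_OPEN)
    (hp : p ≠ 2) (hsst : Semistable W) (hss : GoodSS W p) (h4 : p = 3 → W.frobeniusTrace 3 = 0)
    (K : Type) [Field K] [NumberField K] (hK : Module.finrank ℚ K = 2)
    (hcop : IsCoprime (NumberField.discr K) ((W.conductorNorm ℤ * p : ℕ) : ℤ))
    (hord : ∀ (ℓ : ℕ) [Fact ℓ.Prime], (ℓ : ℤ) ∣ NumberField.discr K → GoodOrd W ℓ)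
    (Wd : WeierstrassCurve ℚ) [Wd.IsElliptic] [Wd.IsGloballyMinimal]
    (hWd : ∃ C : VariableChange ℚ, C • W.quadraticTwist (NumberField.discr K : ℚ) = Wd) (ε : ℤˣ) :
    KobayashiLowerDivisibility Wd p ε :=
  kobayashiLowerDivisibility_of_mainConjecture (hBSTW W p hp hsst hss h4 K hK hcop hord Wd hWd ε)

/-- **The announced twist clause, refereed in the kernel for rank `0`.** IF BSTW Thm. 1.3 with its
twist clause (`hBSTW`, unrefereed) holds, then for every semistable `W` with `p` odd supersingular
((h4) at `p = 3`), every quadratic `K` as in the clause and every globally minimal model `Wd` of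
`E ⊗ χ_K` lying in class X7 with `a_p(Wd) = 0` and `ord_{s=1} L(E ⊗ χ_K, s) = 0`: Miller's
`BSD(E ⊗ χ_K, p)` — from PUBLISHED inputs by name (Wuthrich, Kobayashi Thm. 1.2, Kim Cor. 3.15,
Pollack, modularity, GZK); surjectivity of `ρ̄_{E⊗χ_K,p}` is DERIVED (`ClassX6.surj` for `W`, Serre
Prop. 21 i), transported to the twist by
`twistAdmissible_hasSurjectiveModNGaloisRep_smul_quadraticTwist`).
[claim: BurungaleSkinnerTianWan2024, status: under-review] [cite: Wuthrich2014, Prop. 21 (p. 400)]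
[cite: Serre1972, §5.4 Prop. 21 i)] [cite: SilvermanAEC2009, X.5 Cor. 5.4] -/
theorem X7.bsdp_of_BSTW13_twist_OPEN_of_analyticRank_eq_zero
    (hBSTW : BurungaleSkinnerTianWan2024_thm13_twist_OPEN)
    (hW : Wuthrich2014.sha_dvd_analyticSha)
    (h12 : Kobayashi2003.thm12_signedSelmerDual_finite_torsion)
    (hKim : BDKim2013.cor315_signedCharValue_rankZero)
    (hmod : nonempty_modularParametrizationData) (hmod' : hasEntireLFunction_rat)
    (hGZK : rank_eq_analyticRank_of_analyticRank_le_one)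
    (hp : p ≠ 2) (hsst : Semistable W) (hss : GoodSS W p) (h4 : p = 3 → W.frobeniusTrace 3 = 0)
    (K : Type) [Field K] [NumberField K] (hK : Module.finrank ℚ K = 2)
    (hcop : IsCoprime (NumberField.discr K) ((W.conductorNorm ℤ * p : ℕ) : ℤ))
    (hord : ∀ (ℓ : ℕ) [Fact ℓ.Prime], (ℓ : ℤ) ∣ NumberField.discr K → GoodOrd W ℓ)
    (Wd : WeierstrassCurve ℚ) [Wd.IsElliptic] [Wd.IsGloballyMinimal]
    (hWd : ∃ C : VariableChange ℚ, C • W.quadraticTwist (NumberField.discr K : ℚ) = Wd)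
    (hPollack : ∀ {N : ℕ} [NeZero N] {f : CuspForm (Gamma0 N) 2},
      pollack_exists_plusMinusPAdicLFunction (W := Wd) (f := f) (p := p))
    (hXd : ClassX7 Wd p) (hapd : Wd.frobeniusTrace p = 0) (h0 : Wd.analyticRank = 0) :
    BSDp Wd p := by
  -- `W` is an X6 pair at `p`, so `ρ̄_{E,p}` is onto (Serre), hence so is `ρ̄_{E⊗χ_K,p}`
  have hX6 : ClassX6 W p := by
    refine ⟨hss, hsst, ?_⟩
    by_cases hp3 : p = 3
    · exact Or.inr (h4 hp3)
    · exact Or.inl ((Fact.out : p.Prime).five_le_of_ne_two_of_ne_three hp hp3)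
  have hsW : Surj W p := ClassX6.surj W p hp hX6
  obtain ⟨C, hC⟩ := hWd
  have hD0 : (NumberField.discr K : ℚ) ≠ 0 := by exact_mod_cast NumberField.discr_ne_zero K
  have hsd : Surj Wd p := by
    rw [← hC]
    exact Summit.BirchSwinnertonDyer.BirchSwinnertonDyer.Theorems.twistAdmissible_hasSurjectiveModNGaloisRep_smul_quadraticTwist
      W hD0 C p hsW
  exact X7.bsdp_of_kobayashiLowerDivisibility_of_surj_of_analyticRank_eq_zero Wd p hW h12 hKim
    hPollack hmod hmod' hGZK hp hXd hapd hsd h0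
    (kobayashiLowerDivisibility_of_BSTW13_twist_OPEN W p hBSTW hp hsst hss h4 K hK hcop hord Wd
      ⟨C, hC⟩ 1)

end X7

end Summit.BirchSwinnertonDyer.Rank1Residual.Supersingular

end
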